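import Summits.HodgeConjecture.HodgeConjecture.Theses.MotivatedLefschetzSplit
import Literature.AlgebraicGeometry.HodgeTheory.MotivatedGaloisGroup

/-!
# Birth skeleton (BC3) for crux `HodgeClassesMotivated` (stmt-HodgeConjecture-17488) of route
`MotivatedLefschetzSplit` — line `birth`: the TANNAKIAN SPLIT `HM ⟸ [G¹_mot connected] ∧ [Lie Hg = Lie G¹_mot] ∧ André §4.6 (ii)`

Skeleton registrar `planner-skel-stmt-HodgeConjecture-17488-0` (2026-08-17), published as
`Cruxes/HodgeClassesMotivated/Lines/birth.lean`.

The crux (FIXED; the route's decl, rank 2, grounded `new/open-problem`, checked 2026-08-17):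
`HodgeClassesMotivated` (HM) — on every smooth projective complex `n`-fold `X`, every rational class
of Hodge type `(p,p)` in the deep middle `2 ≤ p ≤ n/2` lies in André's space of motivated classes
`A_motᵖ(X)_ℂ = motivatedClasses n X p` (Y. André, *Pour une théorie inconditionnelle des motifs*,
Publ. Math. IHÉS 83 (1996), Déf. 1).

## The line

André, §6.3 (p. 31), proves HM for an abelian variety `A` and adds: "En remplaçant `A` par ses
puissances, on en déduit que `G_MT(A)` coïncide avec `G_mot(A)`"; §6.2 (p. 31): "Pour `K ⊆ ℂ` et
`H = H_B`, `G_H(A)` contient le groupe de Mumford–Tate"; §4.6 (ii) (p. 24): "`G(M)` est le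
sous-groupe algébrique de `GL(H_B(M))` qui fixe les cycles motivés parmi les tenseurs mixtes sur
`H_B(M)`; réciproquement, tout tenseur mixte sur `H_B(M)` fixé par `G(M)` est motivé"; Remarque (ii)
(p. 25): "Même dans le contexte des cycles de Hodge absolus, et pour `K = ℂ`, la connexité des
groupes de Galois motiviques ne semble pas connue". On the tree's REAL-CARRIER, Tannaka-free
renderings (`Literature/AlgebraicGeometry/HodgeTheory/MotivatedGaloisGroup.lean`, the route's
definition request `defn-MotivatedGaloisGroup`, landed): `specialMotivatedGaloisGroup n X = G¹_mot(X)(ℂ)`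
(the common stabiliser in `∏ₖ GL(Hᵏ(X(ℂ); ℂ))` of all motivated classes on all powers `X^{×(a+1)}`),
`hodgeGroup n X = Hg(X)(ℂ)` (the common stabiliser of all rational `(p,p)`-classes on all powers),
`neutralComponent K = K⁰` and `IsNeutral K` ("`K` is connected": no proper finite-index subgroup).
Always `Hg(X) ≤ G¹_mot(X)` (motivated ⇒ Hodge, §2.5 c); tree: `hodgeGroup_le_specialMotivatedGaloisGroup`),
and HM for all `X` is, on paper, EQUIVALENT to `Hg(X) = G¹_mot(X)` for all `X` (tree, both provable
directions: `hodgeGroup_eq_specialMotivatedGaloisGroup_of_forall_mem_motivatedClasses`,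
`mem_motivatedClasses_of_hodgeGroup_eq`). The equality of the two reductive groups splits into two
INDEPENDENT open statements of different nature — components and Lie algebras:

* `stub_specialMotivatedGaloisGroup_isNeutral` — **(π₀) `G¹_mot(X)` is connected** for every smooth
  projective complex `X`. OPEN (André Remarque (ii) p. 25; "Je ne sais toutefois pas montrer que
  `G_ℂ` est connexe", ibid.). Implied by HM on paper (then `G¹_mot(X) = Hg(X)`, the `ℂ`-points of the
  connected Hodge group, Deligne LNM 900 I §3); known for abelian varieties and varieties motivated
  by them (André §6.3, Thm. 0.6.3). Arithmetic flavour: a finite quotient of `G¹_mot(X)` would be a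
  "phantom" finite motivated Galois action over the algebraically closed field `ℂ`.
* `stub_neutralComponent_le_hodgeGroup` — **(Lie) `G¹_mot(X)⁰ ≤ Hg(X)`**, i.e. `Lie G_mot(X) =
  Lie MT(X)`, i.e. every rational Hodge class on every power of `X` has a FINITE `G¹_mot(X)`-orbit
  (its line a finite `G_mot(X)`-orbit). OPEN; the HARDEST stub (it carries the variational content: Hodge loci versus André's motivic
  exceptional loci, Thm. 5.2 p. 26 and Remarque (vi) p. 27 / Cattani–Deligne–Kaplan). Implied by HM
  on paper (`G¹_mot = Hg`); known for abelian varieties (André §6.3) and abelian-motivated `X`.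
* `stub_invariants_motivated` — **(ii) the invariants of `G¹_mot(X)` in `H²ᵖ(X(ℂ); ℂ)` are
  motivated**, verbatim the tree's named fact `Andre1996_specialMotivatedGaloisGroup_invariants_le`
  (André §4.6 (ii) for `M = h(X)`; a THEOREM in print resting on Thm. 0.4 — Tannakian reconstruction
  and semisimplicity of the motivated category; cite-grade in the tree, XL to formalise).

`HodgeClassesMotivated_of (h₀ : type_of% stub_(π₀)) (hLie : type_of% stub_(Lie)) (hii : type_of% stub_(ii)) :
HodgeClassesMotivated` is kernel-checked below (no `sorry` outside the three `stub_*`; the spelled-out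
implication is `hodgeClassesMotivated_of_spelled`): for a rational `(p,p)`-class `c` on `X` and
`g ∈ G¹_mot(X)`, (π₀) puts `g` in `G¹_mot(X)⁰`, (Lie) puts it in `Hg(X)`, which fixes `c` by
definition (`apply_eq_self_of_mem_hodgeGroup`); so `c` is a `G¹_mot(X)`-invariant and (ii) makes it
motivated. The deep-middle restriction of the crux is not used (the stubs give "Hodge ⇒ motivated"
in every degree, as HM + Lefschetz (1,1) + hard Lefschetz do on paper).

Why this split and not the anchor line. The route header foresaw two first lines for HM: the
ANCHOR line "HM ⟸ MotivatedAnchors + André's deformation Thm. 0.5" and this Tannakian one (card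
`dynkin-menu-intermediate-groups`: "HM ⟺ [G_mot connected] ∧ [MT = G_mot⁰]"). The anchor line is
already registered in the tree, verbatim, as `Cruxes/SummitOffWeilSector/Lines/motivated_anchor_split.lean`
(its `stub_motivatedAnchors` is equivalent to HM given Thm. 0.5, one open stub); this file registers
the OTHER line, whose two open stubs are each strictly weaker than HM on paper and jointly give it —
a genuine two-piece split of the open content, with the theorem-grade seam (ii) named.

## Disproof / negatives honoured

No `Disproof.lean` exists for this crux (no workfiles before this one; `ledger crux ls`), no
`Theorems/HodgeClassesMotivated/Negative/` lemma; `ledger negatives --problem HodgeConjecture`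
(3 entries: MilnorKExponentialSymbolLift, DerivedTorelliFermatK3Exhaustion, ELineConnectivity) —
none concerns motivated classes, Mumford–Tate or motivated Galois groups. The refuter's standing
analysis of the item (2026-08-17T05:13Z): `S → C` proved (`hodgeClassesMotivated_of_hodgeConjecture`),
`C → S` absent (needs `B`); both stubs (π₀), (Lie) are consequences of HM on paper, hence not "more
false than the crux".

## BC3 probes (planner folder `bc/`, raw outputs quoted in NOTES.md; 2026-08-17)

For each stub `T` and each target `C ∈ {HodgeClassesMotivated, HodgeConjecture}` the probes
`example : T → C := by exact?` / `simpa` / `aesop` ALL FAIL (files `bc/probe2_<stub>.lean`, one tactic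
per example; `bc/probe3_diag.lean`): `exact?` — "could not close the goal" (for the summit target
after `intro n X hX`, since `exact?` on the bare constant `HodgeConjecture` times out at `whnf` even
with NO hypothesis, baseline (b0)); `simpa` — "Tactic `assumption` failed"; `aesop` — "failed to
prove the goal after exhaustive search". `lean search` finds no theorem mentioning `IsNeutral`,
`neutralComponent` or `Andre1996_specialMotivatedGaloisGroup_invariants_le` outside
`MotivatedGaloisGroup.lean`: no landed `T → C`. No stub is cheaply the crux or the summit.

## References

* [Andre1996Motifs] Y. André, Publ. Math. IHÉS 83 (1996) 5–49: Thm. 0.4 (p. 8), §2.5 c) (p. 18),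
  §4.6 Définition, (i)–(ii) (p. 24), Remarque (ii) (p. 25), Cor. 5.1, Thm. 5.2 (p. 26), Remarque (vi)
  (p. 27), §6.2–6.3 (p. 31).
* [Deligne1982HodgeCycles] P. Deligne, Hodge cycles on abelian varieties, LNM 900 (1982), I §3
  (Prop. 3.1 (c), 3.4, 3.6).
* [CattaniDeligneKaplan1995] E. Cattani, P. Deligne, A. Kaplan, On the locus of Hodge classes,
  J. Amer. Math. Soc. 8 (1995).
-/

set_option linter.dupNamespace false

noncomputable section

open Literature.AlgebraicGeometry.Motives Literature.AlgebraicGeometry.HodgeTheory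

namespace Summit.HodgeConjecture.HodgeConjecture.Cruxes.HodgeClassesMotivated.Birth

open Summit.HodgeConjecture.HodgeConjecture.Theses.MotivatedLefschetzSplit

/-! ## Registered stubs -/

/-- **(π₀) The special motivated Galois group of a smooth projective complex variety is connected.**
For `X` smooth projective of dimension `n` over `ℂ`, `G¹_mot(X)(ℂ) = specialMotivatedGaloisGroup n X`
(the stabiliser in `∏ₖ GL(Hᵏ(X(ℂ); ℂ))` of all motivated classes on all powers of `X`) has no proper
subgroup of finite index (`IsNeutral`: for the `ℂ`-points of a linear algebraic group over `ℂ`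
exactly "connected"). OPEN — André 1996 Remarque (ii) p. 25: "la connexité des groupes de Galois
motiviques ne semble pas connue (l'argument donné en faveur de cette connexité dans [DM82], 6.22 a
est incomplet)" (the question there is for `G_mot = w(𝔾_m) · G¹_mot`; connectedness of `G¹_mot`
gives it). Consequence of HM on paper (`G¹_mot(X) = Hg(X)`, connected); known for abelian
varieties (`G_mot(A) = MT(A)`, §6.3 p. 31) and for `X` whose motive lies in the Tannakian category
generated by abelian varieties (full faithfulness of the Betti–Hodge realisation there, §6.3;
Thm. 0.6.3). CONJECTURE-GRADE. [cite: Andre1996Motifs, §4.6 Remarque (ii) (p. 25) and §6.3 (p. 31)] -/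
theorem stub_specialMotivatedGaloisGroup_isNeutral :
    ∀ ⦃n : ℕ⦄ ⦃X : SchemeOver ℂ⦄, IsSmoothProjective n X →
      IsNeutral (specialMotivatedGaloisGroup n X) := by
  sorry

/-- **(Lie) The neutral component of `G¹_mot(X)` fixes every rational Hodge class on every power of
`X`: `G¹_mot(X)⁰ ≤ Hg(X)`** — equivalently (with `Hg ≤ G¹_mot`, André §2.5 c) / §6.2) `Hg(X)` has
finite index in `G¹_mot(X)`, `Lie MT(X) = Lie G_mot(X)`, every rational `(p,p)`-class on every
`X^{×(a+1)}` has a finite `G¹_mot(X)`-orbit (its line a finite `G_mot(X)`-orbit). OPEN; the hardest stub of the line (variational content: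
for `X` very general in a family the two Lie algebras both contain the algebraic monodromy —
André Thm. 5.2 / Cor. 5.1 p. 26 on the motivated side, Remarque (vi) p. 27 with Cattani–Deligne–
Kaplan on the Hodge side — and the statement is their comparison at EVERY point). Consequence of HM
on paper; known for abelian varieties (§6.3) and abelian-motivated `X`. CONJECTURE-GRADE.
[cite: Andre1996Motifs, §6.2–6.3 (p. 31), Thm. 5.2 and Cor. 5.1 (p. 26), Remarque (vi) (p. 27)]
[cite: Deligne1982HodgeCycles, I §3 Prop. 3.4 and 3.6] -/
theorem stub_neutralComponent_le_hodgeGroup :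
    ∀ ⦃n : ℕ⦄ ⦃X : SchemeOver ℂ⦄, IsSmoothProjective n X →
      neutralComponent (specialMotivatedGaloisGroup n X) ≤ hodgeGroup n X := by
  sorry

/-- **(ii) The invariants of `G¹_mot(X)` in `H²ᵖ(X(ℂ); ℂ)` are motivated** — verbatim the tree's
named fact `Andre1996_specialMotivatedGaloisGroup_invariants_le` (André 1996 §4.6 (ii), p. 24:
"réciproquement, tout tenseur mixte sur `H_B(M)` fixé par `G(M)` est motivé", for `M = h(X)` and the
tensor space `H²ᵖ(X)(p)`, in the `G¹`-form of `MotivatedGaloisGroup.lean`). THEOREM in print, resting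
on Thm. 0.4 (the motivated category is Tannakian and semisimple); cite-grade in the tree (no
Tannakian reconstruction in Mathlib), XL to formalise. [cite: Andre1996Motifs, §4.6 (ii) (p. 24) with Thm. 0.4 (p. 8)] -/
theorem stub_invariants_motivated : Andre1996_specialMotivatedGaloisGroup_invariants_le := by
  sorry

/-! ## Kernel-checked composition -/

/-- **The line concludes the crux BY NAME**: `(π₀) → (Lie) → (ii) → HodgeClassesMotivated`.
Given a rational `(p,p)`-class `c` on the smooth projective `X` and `g ∈ G¹_mot(X)`: by (π₀)
`G¹_mot(X) = G¹_mot(X)⁰`, so by (Lie) `g ∈ Hg(X)`, which fixes `c` (`apply_eq_self_of_mem_hodgeGroup`,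
definitional); hence `c` is `G¹_mot(X)`-invariant and (ii) makes it motivated. (André §6.3 p. 31 read
backwards: "`G_MT` coïncide avec `G_mot`" ⇒ Hodge classes are motivated.) [cite: Andre1996Motifs, §4.6 (ii) (p. 24) and §6.3 (p. 31)] -/
theorem HodgeClassesMotivated_of
    (h₀ : type_of% stub_specialMotivatedGaloisGroup_isNeutral)
    (hLie : type_of% stub_neutralComponent_le_hodgeGroup)
    (hii : type_of% stub_invariants_motivated) :
    HodgeClassesMotivated := by
  intro n X hX p _ _ c hc hpp
  exact hii hX p c fun g hg ↦
    apply_eq_self_of_mem_hodgeGroup (hLie hX ((h₀ hX).symm.le hg)) hc hpp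

/-- The same composition with the three stub statements spelled out (no `type_of%`), for readers and
probes: `(π₀) → (Lie) → (ii) → HodgeClassesMotivated`. [cite: Andre1996Motifs, §4.6 (ii) (p. 24) and §6.3 (p. 31)] -/
theorem hodgeClassesMotivated_of_spelled :
    (∀ ⦃n : ℕ⦄ ⦃X : SchemeOver ℂ⦄, IsSmoothProjective n X →
        IsNeutral (specialMotivatedGaloisGroup n X)) →
    (∀ ⦃n : ℕ⦄ ⦃X : SchemeOver ℂ⦄, IsSmoothProjective n X →
        neutralComponent (specialMotivatedGaloisGroup n X) ≤ hodgeGroup n X) →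
    Andre1996_specialMotivatedGaloisGroup_invariants_le →
    HodgeClassesMotivated :=
  fun h₀ hLie hii ↦ HodgeClassesMotivated_of h₀ hLie hii

/-- The registered stubs compose to the crux (instantiation of `HodgeClassesMotivated_of`; depends on
the three `stub_*` and on nothing else unproved). [cite: Andre1996Motifs, §6.3 (p. 31)] -/
theorem hodgeClassesMotivated_of_stubs : HodgeClassesMotivated :=
  HodgeClassesMotivated_of stub_specialMotivatedGaloisGroup_isNeutral
    stub_neutralComponent_le_hodgeGroup stub_invariants_motivated

/-- Alias in the skeleton checker's `<Crux>_proof` spelling. [cite: Andre1996Motifs, §6.3 (p. 31)] -/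
theorem HodgeClassesMotivated_proof : HodgeClassesMotivated :=
  hodgeClassesMotivated_of_stubs

end Summit.HodgeConjecture.HodgeConjecture.Cruxes.HodgeClassesMotivated.Birth

end
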